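import Mathlib.Analysis.Calculus.FDeriv.Equiv
import Mathlib.MeasureTheory.Measure.Haar.NormedSpace
import Literature.Analysis.FluidPDE.LocalBiotSavartLog
import HarnessLib

/-!
# Crux `TypeIliouvilleNoTypeII` (stmt-NavierStokesRegularity-0056), line `Sketch` (gradient-bkm-pivot):
  STUB `stub_threeFifthsLawCurl` — the kinematic 3/5 law, vorticity form

Lands `--supports stmt-NavierStokesRegularity-0056` the registered stub `stub_threeFifthsLawCurl` of
the lead's skeleton: there is an absolute constant `C > 0` such that every smooth divergence-free
square-integrable `v : ℝ³ → ℝ³` with `‖curl v‖ ≤ Ω` everywhere obeys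

  `‖v(x)‖ ≤ C (∫ ‖v‖²)^{1/5} Ω^{3/5}`  for every `x`

(dimensional check `[L T⁻¹] = [L⁵ T⁻²]^{1/5} [T⁻¹]^{3/5}`).

Proof.

* **Unit scale** (`exists_norm_le_unitScale`). The tree's local Biot–Savart law
  (`LocalBiotSavart.eqOn_coord_localRep`, Tao 2011 §10 / Majda–Bertozzi §2.4.1) on the unit ball
  about `x` writes each component as
  `vₘ(x) = -(∂ₘ₊₁N[ψωₘ₊₂](x) - ∂ₘ₊₂N[ψωₘ₊₁](x)) + Λ[ψvₘ](x)`, `N` the truncated Newtonian potential at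
  radii `(1/2, 1)`, `Λ` the smoothing by the unit-scale kernel `λ = Δ((1-θ)Γ)`, `ψ` the ball cutoff.
  The first derivatives of `N` are absolutely convergent gradient potentials
  (`fderiv_newtonNearPotential_eq_newtonNearGradPotential`) of the bounded densities `ψω_b`
  (`|ψω_b| ≤ Ω`), hence `≤ c₁ Ω` (`norm_newtonNearGradPotential_le`, Majda–Bertozzi Lemma 4.5);
  the smoothing term is `∫ ψvₘ(y) λ(x - y) dy`, bounded by Cauchy–Schwarz by `‖λ‖₂ ‖v‖₂`.  Hence
  `‖v(x)‖ ≤ A Ω + B ‖v‖₂` with absolute `A, B`.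
* **Scaling.** Applied to `y ↦ v(ℓy)` (`curl = ℓ (curl v)(ℓ·)`, `∫‖v(ℓ·)‖² = ℓ⁻³ ∫‖v‖²`, still
  smooth, divergence free and square integrable) this gives, for every `ℓ > 0`,
  `‖v(x)‖ ≤ A ℓ Ω + B ℓ^{-3/2} ‖v‖₂`; the choice `ℓ⁵ = ‖v‖₂²/Ω²` gives the claim with `C = A + B + 1`,
  and the degenerate cases `‖v‖₂ = 0` / `Ω = 0` follow by letting `ℓ → 0⁺` / `ℓ → ∞`.
-/

noncomputable section

-- the summit and its single problem share the name (D-0017 nested layout)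
set_option linter.dupNamespace false

open Set Function Filter Topology MeasureTheory Metric
open scoped NNReal ENNReal ContDiff

namespace Summit.NavierStokesRegularity.NavierStokesRegularity.Theorems.TypeIliouvilleNoTypeII.GradientPivot

open Literature.Analysis Literature.Analysis.FluidPDE

/-- `ℝ³` (the lead's skeleton states the stub with this local notation). -/
local notation "E3" => EuclideanSpace ℝ (Fin 3)

/-! ### Dilations of vector fields -/

/-- **Curl of a dilation**: `curl (v(c ·))(x) = c • (curl v)(c x)` for every `c : ℝ`, with no
differentiability hypothesis (both sides are junk `0` together; Mathlib's `fderiv_comp_smul`).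
[folklore] -/
theorem curl_comp_smul (v : E3 → E3) (c : ℝ) (x : E3) :
    curl (fun y => v (c • y)) x = c • curl v (c • x) := by
  simp only [curl, _root_.fderiv_comp_smul]
  ext i
  fin_cases i <;> simp <;> ring

/-- A divergence-free field composed with a homothety is divergence free
(`div (v(a ·))(x) = a (div v)(a x)`). [folklore] -/
theorem isDivFree_comp_smul {v : E3 → E3} (h : VectorCalculus.IsDivFree v) (a : ℝ) :
    VectorCalculus.IsDivFree (fun x => v (a • x)) := by
  intro x
  have hx := h (a • x)
  simp only [VectorCalculus.divergence] at hx ⊢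
  rw [_root_.fderiv_comp_smul, ContinuousLinearMap.toLinearMap_smul, map_smul, hx, smul_zero]

/-! ### The smoothing term of the local Biot–Savart law, `L²` form -/

/-- **`|Λ[g](x)| ≤ ‖g‖₂ ‖λ‖₂`**: the smoothing remainder `Λ[g](x) = ∫ g(y) λ(x - y) dy` of Green's
representation at radii `(r₀, r₁)` is bounded by Cauchy–Schwarz, for `g` continuous with compact
support. [folklore] -/
theorem abs_newtonFarSmoothing_le_sqrt {r₀ r₁ : ℝ} (h₀ : 0 < r₀) (h₁ : r₀ < r₁) {g : E3 → ℝ}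
    (hg : Continuous g) (hgc : HasCompactSupport g) (x : E3) :
    |newtonFarSmoothing r₀ r₁ g x| ≤
      Real.sqrt (∫ y, g y ^ 2) * Real.sqrt (∫ z, newtonFarLaplacian r₀ r₁ z ^ 2) := by
  have hshift : ∫ y, newtonFarLaplacian r₀ r₁ (x - y) ^ 2 = ∫ z, newtonFarLaplacian r₀ r₁ z ^ 2 :=
    integral_sub_left_eq_self (fun z => newtonFarLaplacian r₀ r₁ z ^ 2) volume x
  rw [newtonFarSmoothing_eq_integral_kernel, ← hshift]
  have hkc : Continuous fun y => newtonFarLaplacian r₀ r₁ (x - y) :=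
    (continuous_newtonFarLaplacian h₀ h₁).comp (continuous_const.sub continuous_id)
  have hks : HasCompactSupport fun y => newtonFarLaplacian r₀ r₁ (x - y) := by
    refine HasCompactSupport.intro (isCompact_closedBall x r₁) fun y hy => ?_
    rw [mem_closedBall, dist_comm, dist_eq_norm, not_le] at hy
    exact newtonFarLaplacian_eq_zero_of_gt h₀.le h₁ hy
  calc |∫ y, g y * newtonFarLaplacian r₀ r₁ (x - y)|
      ≤ ∫ y, |g y * newtonFarLaplacian r₀ r₁ (x - y)| := abs_integral_le_integral_abs
    _ = ∫ y, |g y| * |newtonFarLaplacian r₀ r₁ (x - y)| := by simp only [abs_mul]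
    _ ≤ Real.sqrt (∫ y, g y ^ 2) * Real.sqrt (∫ y, newtonFarLaplacian r₀ r₁ (x - y) ^ 2) :=
        integral_abs_mul_abs_le_sqrt (hg.memLp_of_hasCompactSupport hgc)
          (hkc.memLp_of_hasCompactSupport hks)

/-! ### The sup bound at unit scale -/

/-- **Local Biot–Savart at unit scale**: there are absolute constants `A, B ≥ 0` such that every
smooth divergence-free `v : ℝ³ → ℝ³` with `∫‖v‖² < ∞` and `‖curl v‖ ≤ Ω` obeys
`‖v(x)‖ ≤ A Ω + B (∫‖v‖²)^{1/2}` at every point: on the unit ball about `x`,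
`vₘ = -(∂ₘ₊₁N[ψωₘ₊₂] - ∂ₘ₊₂N[ψωₘ₊₁]) + Λ[ψvₘ]` (`eqOn_coord_localRep`); the gradient potentials of
the bounded densities `ψω_b` are `≤ c₁Ω` (`norm_newtonNearGradPotential_le`, Majda–Bertozzi
Lemma 4.5 localised) and `|Λ[ψvₘ](x)| ≤ ‖λ‖₂‖v‖₂` (`abs_newtonFarSmoothing_le_sqrt`).
[cite: MajdaBertozziCUP2002, §2.4.1 (Biot–Savart law) and §4.1.3 Lemma 4.5] -/
theorem exists_norm_le_unitScale :
    ∃ A B : ℝ, 0 ≤ A ∧ 0 ≤ B ∧ ∀ (v : E3 → E3) (Ω : ℝ), ContDiff ℝ ∞ v →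
      VectorCalculus.IsDivFree v → Integrable (fun y => ‖v y‖ ^ 2) → 0 ≤ Ω →
      (∀ y, ‖curl v y‖ ≤ Ω) → ∀ x, ‖v x‖ ≤ A * Ω + B * Real.sqrt (∫ y, ‖v y‖ ^ 2) := by
  have h₀ : (0 : ℝ) < 1 / 2 := by norm_num
  have h₁ : (1 / 2 : ℝ) < 1 := by norm_num
  obtain ⟨C₁, hC₁0, hC₁⟩ := exists_abs_newtonNearGrad_le h₀ h₁
  set K : ℝ := C₁ * (3 * (volume : Measure E3).real (ball 0 1)) with hK
  set L : ℝ := Real.sqrt (∫ z, newtonFarLaplacian (1 / 2) 1 z ^ 2) with hL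
  have hK0 : 0 ≤ K := by positivity
  have hL0 : 0 ≤ L := Real.sqrt_nonneg _
  refine ⟨6 * K, 3 * L, by positivity, by positivity, fun v Ω hv hdiv hint hΩ hcurl x => ?_⟩
  -- the local Biot–Savart law on the unit ball about `x`
  have hrep : ∀ m : Fin 3, v x m = localRep v x 1 m x := fun m =>
    eqOn_coord_localRep hv hdiv one_pos m (mem_ball_self one_pos)
  -- the near terms: gradient potentials of the bounded densities `ψω_b`
  have hnear : ∀ a b : Fin 3,
      |fderiv ℝ (newtonNearPotential (1 / 2) 1 (locVort v x 1 b)) x (EuclideanSpace.single a 1)| ≤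
        K * Ω := by
    intro a b
    have hMf : ∀ y, ‖locVort v x 1 b y‖ ≤ Ω := fun y => by
      rw [locVort, norm_mul, Real.norm_eq_abs]
      calc |ballCutoff x 1 y| * ‖curl v y b‖ ≤ 1 * Ω :=
            mul_le_mul (abs_ballCutoff_le_one x 1 y) ((PiLp.norm_apply_le (curl v y) b).trans (hcurl y))
              (norm_nonneg _) zero_le_one
        _ = Ω := one_mul _
    rw [fderiv_newtonNearPotential_eq_newtonNearGradPotential h₀ h₁ (contDiff_locVort hv x 1 b)
      (hasCompactSupport_locVort one_pos v b), ← Real.norm_eq_abs]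
    have h := norm_newtonNearGradPotential_le h₀ h₁ hC₁0 hC₁ (EuclideanSpace.single a (1 : ℝ)) hΩ hMf x
    have hna : ‖(EuclideanSpace.single a (1 : ℝ) : E3)‖ = 1 := by simp
    rw [hna, mul_one, mul_one] at h
    calc ‖newtonNearGradPotential (1 / 2) 1 (EuclideanSpace.single a (1 : ℝ)) (locVort v x 1 b) x‖
        ≤ C₁ * Ω * (3 * (volume : Measure E3).real (ball 0 1)) := h
      _ = K * Ω := by rw [hK]; ring
  -- the smoothing term: Cauchy–Schwarz against the unit-scale kernel
  have hfar : ∀ m : Fin 3,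
      |newtonFarSmoothing (1 / 2) 1 (locVel v x 1 m) x| ≤ Real.sqrt (∫ y, ‖v y‖ ^ 2) * L := by
    intro m
    have hΦc : Continuous (locVel v x 1 m) := (contDiff_locVel hv x 1 m (n := 0)).continuous
    have hΦs : HasCompactSupport (locVel v x 1 m) := hasCompactSupport_locVel one_pos v m
    have hΦ2 : ∫ y, locVel v x 1 m y ^ 2 ≤ ∫ y, ‖v y‖ ^ 2 :=
      integral_mono (integrable_sq_of_hasCompactSupport hΦc hΦs) hint fun y => by
        calc locVel v x 1 m y ^ 2 = |locVel v x 1 m y| ^ 2 := (sq_abs _).symm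
          _ ≤ ‖v y‖ ^ 2 := pow_le_pow_left₀ (abs_nonneg _) (abs_locVel_le v x 1 m y) 2
    calc |newtonFarSmoothing (1 / 2) 1 (locVel v x 1 m) x|
        ≤ Real.sqrt (∫ y, locVel v x 1 m y ^ 2) * L := abs_newtonFarSmoothing_le_sqrt h₀ h₁ hΦc hΦs x
      _ ≤ Real.sqrt (∫ y, ‖v y‖ ^ 2) * L :=
          mul_le_mul_of_nonneg_right (Real.sqrt_le_sqrt hΦ2) hL0
  -- each coordinate
  have key : ∀ p q s α β : ℝ, |p| ≤ α → |q| ≤ α → |s| ≤ β → |-(p - q) + s| ≤ 2 * α + β := by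
    intro p q s α β hp hq hs
    calc |-(p - q) + s| ≤ |-(p - q)| + |s| := abs_add_le _ _
      _ ≤ (|p| + |q|) + |s| := by rw [abs_neg]; linarith [abs_sub p q]
      _ ≤ (α + α) + β := by gcongr
      _ = 2 * α + β := by ring
  have hcoord : ∀ m : Fin 3, |v x m| ≤ 2 * (K * Ω) + Real.sqrt (∫ y, ‖v y‖ ^ 2) * L := by
    intro m
    rw [hrep m, localRep]
    exact key _ _ _ _ _ (hnear _ _) (hnear _ _) (hfar m)
  calc ‖v x‖ ≤ ∑ m, |v x m| := norm_le_sum_abs_coord (v x)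
    _ ≤ ∑ _m : Fin 3, (2 * (K * Ω) + Real.sqrt (∫ y, ‖v y‖ ^ 2) * L) :=
        Finset.sum_le_sum fun m _ => hcoord m
    _ = 6 * K * Ω + 3 * L * Real.sqrt (∫ y, ‖v y‖ ^ 2) := by
        simp only [Finset.sum_const, Finset.card_univ, Fintype.card_fin, nsmul_eq_mul, Nat.cast_ofNat]
        ring

/-! ### The stub -/

/-- **STUB `stub_threeFifthsLawCurl` — the kinematic 3/5 law, vorticity form.**  There is an
absolute constant `C > 0` such that every smooth divergence-free square-integrable
`v : ℝ³ → ℝ³` with `‖curl v‖ ≤ Ω` everywhere obeys `‖v(x)‖ ≤ C (∫ ‖v‖²)^{1/5} Ω^{3/5}`: the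
unit-scale local Biot–Savart bound `‖v(x)‖ ≤ A Ω + B ‖v‖₂` (`exists_norm_le_unitScale`) applied
to the dilations `v(ℓ ·)` gives `‖v(x)‖ ≤ A ℓ Ω + B ℓ^{-3/2} ‖v‖₂` for every `ℓ > 0`; optimise
`ℓ⁵ = ‖v‖₂²/Ω²` (and let `ℓ → 0⁺`, `ℓ → ∞` in the degenerate cases `‖v‖₂ = 0`, `Ω = 0`).
[cite: MajdaBertozziCUP2002, §2.4.1 (Biot–Savart law)] -/
theorem stub_threeFifthsLawCurl :
    ∃ C : ℝ, 0 < C ∧ ∀ (v : E3 → E3) (Ω : ℝ), ContDiff ℝ (⊤ : ℕ∞) v →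
      VectorCalculus.IsDivFree v → MemLp v 2 volume → 0 ≤ Ω → (∀ x, ‖curl v x‖ ≤ Ω) →
      ∀ x, ‖v x‖ ≤ C * (∫ y, ‖v y‖ ^ 2) ^ (1 / 5 : ℝ) * Ω ^ (3 / 5 : ℝ) := by
  obtain ⟨A, B, hA, hB, hAB⟩ := exists_norm_le_unitScale
  refine ⟨A + B + 1, by positivity, fun v Ω hv hdiv hv2 hΩ hcurl x => ?_⟩
  have hint : Integrable (fun y => ‖v y‖ ^ 2) := (memLp_two_iff_integrable_sq_norm hv2.1).1 hv2
  set E : ℝ := ∫ y, ‖v y‖ ^ 2 with hE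
  have hE0 : 0 ≤ E := integral_nonneg fun y => by positivity
  have hR0 : 0 ≤ (A + B + 1) * E ^ (1 / 5 : ℝ) * Ω ^ (3 / 5 : ℝ) :=
    mul_nonneg (mul_nonneg (by positivity) (Real.rpow_nonneg hE0 _)) (Real.rpow_nonneg hΩ _)
  -- the unit-scale bound applied to the dilations `y ↦ v (ℓ • y)`
  have hscale : ∀ l : ℝ, 0 < l → ‖v x‖ ≤ A * (l * Ω) + B * Real.sqrt ((l ^ 3)⁻¹ * E) := by
    intro l hl
    have hwc : ContDiff ℝ ∞ (fun y => v (l • y)) := hv.comp (contDiff_const_smul l)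
    have hwint : Integrable (fun y => ‖v (l • y)‖ ^ 2) :=
      (integrable_comp_smul_iff volume (fun y => ‖v y‖ ^ 2) hl.ne').2 hint
    have hwE : ∫ y, ‖v (l • y)‖ ^ 2 = (l ^ 3)⁻¹ * E := by
      have h := Measure.integral_comp_smul_of_nonneg volume (fun y => ‖v y‖ ^ 2) l (hR := hl.le)
      rw [finrank_euclideanSpace_fin, smul_eq_mul] at h
      exact h
    have hwcurl : ∀ y, ‖curl (fun y => v (l • y)) y‖ ≤ l * Ω := fun y => by
      rw [curl_comp_smul, norm_smul, Real.norm_eq_abs, abs_of_pos hl]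
      exact mul_le_mul_of_nonneg_left (hcurl _) hl.le
    have h := hAB (fun y => v (l • y)) (l * Ω) hwc (isDivFree_comp_smul hdiv l) hwint
      (by positivity) hwcurl (l⁻¹ • x)
    have hx : v (l • l⁻¹ • x) = v x := by rw [smul_smul, mul_inv_cancel₀ hl.ne', one_smul]
    rw [hwE, hx] at h
    exact h
  rcases eq_or_lt_of_le hE0 with hE0' | hEpos
  · -- `‖v‖₂ = 0`: let `ℓ → 0⁺`
    have hv0 : ‖v x‖ ≤ 0 := by
      have ht : Tendsto (fun l : ℝ => A * (l * Ω)) (𝓝[>] (0 : ℝ)) (𝓝 0) := by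
        have h : Tendsto (fun l : ℝ => A * (l * Ω)) (𝓝 0) (𝓝 (A * (0 * Ω))) :=
          (continuous_const.mul (continuous_id.mul continuous_const)).tendsto 0
        rw [zero_mul, mul_zero] at h
        exact h.mono_left nhdsWithin_le_nhds
      refine ge_of_tendsto ht (eventually_nhdsWithin_of_forall fun l (hl : 0 < l) => ?_)
      have h := hscale l hl
      rwa [← hE0', mul_zero, Real.sqrt_zero, mul_zero, add_zero] at h
    exact hv0.trans hR0
  rcases eq_or_lt_of_le hΩ with hΩ0 | hΩpos
  · -- `Ω = 0`: let `ℓ → ∞`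
    have hv0 : ‖v x‖ ≤ 0 := by
      have ht : Tendsto (fun l : ℝ => B * Real.sqrt ((l ^ 3)⁻¹ * E)) atTop (𝓝 0) := by
        have h1 : Tendsto (fun l : ℝ => (l ^ 3)⁻¹) atTop (𝓝 0) :=
          tendsto_inv_atTop_zero.comp (tendsto_pow_atTop three_ne_zero)
        have h2 : Tendsto (fun l : ℝ => B * Real.sqrt ((l ^ 3)⁻¹ * E)) atTop
            (𝓝 (B * Real.sqrt (0 * E))) :=
          ((h1.mul_const E).sqrt).const_mul B
        rwa [zero_mul, Real.sqrt_zero, mul_zero] at h2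
      refine ge_of_tendsto ht ((eventually_gt_atTop (0 : ℝ)).mono fun l hl => ?_)
      have h := hscale l hl
      rwa [← hΩ0, mul_zero, mul_zero, zero_add] at h
    exact hv0.trans hR0
  -- the main case: `ℓ⁵ = E / Ω²`
  obtain ⟨l, hl_def⟩ : ∃ l : ℝ, l = (E / Ω ^ 2) ^ (1 / 5 : ℝ) := ⟨_, rfl⟩
  have hq0 : 0 < E / Ω ^ 2 := div_pos hEpos (pow_pos hΩpos 2)
  have hl : 0 < l := by rw [hl_def]; exact Real.rpow_pos_of_pos hq0 _
  have hl5 : l ^ 5 = E / Ω ^ 2 := by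
    rw [hl_def, ← Real.rpow_natCast, ← Real.rpow_mul hq0.le]
    norm_num
  have hEeq : E = l ^ 5 * Ω ^ 2 := by
    rw [hl5]; field_simp
  have h1 : E ^ (1 / 5 : ℝ) = l * Ω ^ (2 / 5 : ℝ) := by
    rw [hEeq, Real.mul_rpow (pow_nonneg hl.le 5) (pow_nonneg hΩ 2)]
    congr 1
    · rw [← Real.rpow_natCast l 5, ← Real.rpow_mul hl.le]
      norm_num
    · rw [← Real.rpow_natCast Ω 2, ← Real.rpow_mul hΩ]
      norm_num
  have h2 : E ^ (1 / 5 : ℝ) * Ω ^ (3 / 5 : ℝ) = l * Ω := by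
    rw [h1, mul_assoc, ← Real.rpow_add hΩpos]
    norm_num
  have h3 : (l ^ 3)⁻¹ * E = (l * Ω) ^ 2 := by
    rw [hEeq]; field_simp
  have hX : 0 ≤ l * Ω := by positivity
  calc ‖v x‖ ≤ A * (l * Ω) + B * Real.sqrt ((l ^ 3)⁻¹ * E) := hscale l hl
    _ = A * (l * Ω) + B * (l * Ω) := by rw [h3, Real.sqrt_sq hX]
    _ ≤ (A + B + 1) * (l * Ω) := by nlinarith
    _ = (A + B + 1) * E ^ (1 / 5 : ℝ) * Ω ^ (3 / 5 : ℝ) := by rw [mul_assoc, h2]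

end Summit.NavierStokesRegularity.NavierStokesRegularity.Theorems.TypeIliouvilleNoTypeII.GradientPivot

end
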